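import Mathlib
import Literature.AlgebraicGeometry.DuqueFrancoVillaflor2023.MaximalHodgeRank

/-!
# Solo-blind s38 — arithmetic skeleton of the PLANAR THEOREM (composite planar incidence carriers)

Informal source: HOME `work/s38/planar-closure.md` (THEOREM S, LEMMA O, SEP, KERNEL LEMMA, W9, W10,
PLANAR THEOREM). The geometric statements live there; this file kernel-checks the finite arithmetic that
turns them into rank bounds:

* `typeII_impossible` — TYPE II of §5: `1 = dim 𝓠^H · ḡ · a(ρ')` is impossible once `ḡ ≥ 2`.
* `unramified_cases` — TYPE III-sep with Chevalley–Weil `a(ρ) = (ḡ-1)·dim ρ ∈ {1,2}`: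
  `(ḡ, dim ρ) ∈ {(2,1), (3,1), (2,2)}`.
* `galois_window` — COROLLARY §3: Galois stability of the single orbit forces every unit of `ℤ/e`
  to be `±1`, hence `e ∈ {2,3,4,6}` (via the Literature reproduction
  `Literature.AlgebraicGeometry.DuqueFrancoVillaflor2023.forall_units_eq_iff`).
* `glued_rank_le_six`, `glued_rank_le_five_e2`, `seven_excluded`, `face_excluded` — III-glued:
  `dim SO(r) = r(r-1)/2 ≤ dim U(p,q) = (p+q)² = 16` (`p+q = 2(ḡ-1) = 4`) gives `r ≤ 6`; the symplectic
  case `≤ 10` gives `r ≤ 5`; `r = 7, 8` are excluded — in particular the `T₈` face (`r = 8`).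
* `prym_piece_small` — the glued piece `P_[χ]` has `dim_ℚ = 2·φ(e)·(ḡ-1) ≤ 8 < 16 = 2·dim A_ε`
  (comparison with Lemma U, s25).
-/

namespace Summit.HodgeConjecture.HodgeConjecture.Theorems.SoloBlindPlanarClosure

/-- TYPE II (§5): `q · g · a = 1` is impossible in `ℕ` when `g ≥ 2`. -/
theorem typeII_impossible (q g a : ℕ) (hg : 2 ≤ g) : q * g * a ≠ 1 := by
  intro h
  have hdvd : g ∣ 1 := ⟨q * a, by rw [← h]; ring⟩
  have := Nat.le_of_dvd Nat.one_pos hdvd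
  omega

/-- TYPE III-sep (§5) with Chevalley–Weil: `g ≥ 2`, `d ≥ 1`, `(g-1)·d ≤ 2` forces
`(g,d) ∈ {(2,1),(3,1),(2,2)}`. -/
theorem unramified_cases (g d : ℕ) (hg : 2 ≤ g) (hd : 1 ≤ d) (h : (g - 1) * d ≤ 2) :
    (g = 2 ∧ d = 1) ∨ (g = 3 ∧ d = 1) ∨ (g = 2 ∧ d = 2) := by
  have h1 : g - 1 ≤ 2 := le_trans (Nat.le_mul_of_pos_right _ hd) h
  have h2 : d ≤ 2 := le_trans (Nat.le_mul_of_pos_left _ (by omega)) h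
  have hg3 : g ≤ 3 := by omega
  interval_cases g <;> interval_cases d <;> simp_all

/-- COROLLARY §3 (Galois window): if every unit of `ℤ/e` is `±1` and `e ≥ 2` then `e ∈ {2,3,4,6}`. -/
theorem galois_window (e : ℕ) [NeZero e] (he : 2 ≤ e)
    (hU : ∀ u : (ZMod e)ˣ, (u : ZMod e) = 1 ∨ (u : ZMod e) = -1) :
    e = 2 ∨ e = 3 ∨ e = 4 ∨ e = 6 := by
  have h := (Literature.AlgebraicGeometry.DuqueFrancoVillaflor2023.forall_units_eq_iff).mp hU
  omega

/-- The same window from `φ(e) ≤ 2`. -/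
theorem galois_window_totient (e : ℕ) [NeZero e] (he : 2 ≤ e) (h : e.totient ≤ 2) :
    e = 2 ∨ e = 3 ∨ e = 4 ∨ e = 6 := by
  have h := (Literature.AlgebraicGeometry.DuqueFrancoVillaflor2023.totient_le_two_iff).mp h
  omega

/-- III-glued, `e ∈ {3,4,6}`, `ḡ = 3`: `dim SO(r) = r(r-1)/2 ≤ (2·(3-1))² = 16` forces `r ≤ 6`. -/
theorem glued_rank_le_six (r : ℕ) (h : r * (r - 1) / 2 ≤ (2 * (3 - 1)) ^ 2) : r ≤ 6 := by
  by_contra hr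
  have hr7 : 7 ≤ r := by omega
  have : 7 * 6 ≤ r * (r - 1) := Nat.mul_le_mul hr7 (by omega)
  omega

/-- III-glued, `e = 2`, `ḡ = 3`: `dim SO(r) ≤ dim Sp₄ = 2·(2·2+1) = 10` forces `r ≤ 5`. -/
theorem glued_rank_le_five_e2 (r : ℕ) (h : r * (r - 1) / 2 ≤ 2 * (2 * 2 + 1)) : r ≤ 5 := by
  by_contra hr
  have hr6 : 6 ≤ r := by omega
  have : 6 * 5 ≤ r * (r - 1) := Nat.mul_le_mul hr6 (by omega)
  omega

/-- `r = 6` survives the unitary window (`15 ≤ 16`: the `A₃ = D₃` coincidence) and `r = 7` does not. -/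
theorem six_survives_seven_excluded : 6 * (6 - 1) / 2 ≤ 16 ∧ ¬ (7 * (7 - 1) / 2 ≤ 16) := by decide

/-- The `T₈` face (`r = 8`, `dim SO(8) = 28`) is outside every window of the PLANAR THEOREM
(`10`, `16`). -/
theorem face_excluded : ¬ (8 * (8 - 1) / 2 ≤ 16) ∧ ¬ (8 * (8 - 1) / 2 ≤ 10) := by decide

/-- PLANAR THEOREM, numerical form: every window bound `W ≤ 16` on `dim Hg(T) = r(r-1)/2` gives `r ≤ 6`. -/
theorem planar_rank_le_six (r W : ℕ) (hW : W ≤ 16) (h : r * (r - 1) / 2 ≤ W) : r ≤ 6 :=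
  glued_rank_le_six r (le_trans h (by norm_num [hW]))

/-- The glued piece is too small for Lemma U: `dim_ℚ P_[χ] = 2·φ(e)·(ḡ-1) ≤ 8 < 16 = 2·dim A_ε`
when `φ(e) ≤ 2` and `ḡ ≤ 3`. -/
theorem prym_piece_small (e g : ℕ) (hφ : e.totient ≤ 2) (hg : g ≤ 3) :
    2 * e.totient * (g - 1) ≤ 8 ∧ (8 : ℕ) < 16 := by
  refine ⟨?_, by norm_num⟩
  have hg' : g - 1 ≤ 2 := by omega
  calc 2 * e.totient * (g - 1) ≤ 2 * 2 * 2 :=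
        Nat.mul_le_mul (Nat.mul_le_mul_left 2 hφ) hg'
    _ = 8 := by norm_num

/-- Order bookkeeping of THEOREM S: `|G| = d̄! · |M|^d̄ / |Ā|` — the instance computed in s37 §7
(quartic, unramified double cover): `4! · 2⁴ / 2 = 192`. -/
theorem quartic_double_cover_order : Nat.factorial 4 * 2 ^ 4 / 2 = 192 := by decide

end Summit.HodgeConjecture.HodgeConjecture.Theorems.SoloBlindPlanarClosure
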